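import Summits.RiemannHypothesis.RiemannHypothesis.Theorems.PfPersistenceM2ProlateEdge
import HarnessLib

/-!
# M2 upper half — second kernel-checked brick of THEOREM E″: the SECOND-ORDER window-edge identity and Lemma B for i ≤ 2

pub-rhpf cell (M2 seat, generation 3).  HONEST FRAMING: long-odds MECHANISM SEARCH; no RH claims.  Everything here is
PROVED (kernel-checked) from the tree's interface `IsProlateFunction` ALONE (`C²` on the closed window + the
Sturm–Liouville eigen-equation on the open window); nothing mentions zeta.

CONTENT.  Write `f′_w, f″_w` for the first and second derivatives of a prolate function `f` WITHIN the closed window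
`[−λ, λ]`, `C := (2πλ²)²` (`= c²` in prolate units) and `χ` for the eigenvalue.  The companion file proved the closed-window
equation `2x f′_w − (λ² − x²) f″_w + ((2πλx)² − χ) f = 0` on `[−λ, λ]` and the `i = 0` edge identity
`2λ f′_w(λ) = (χ − C) f(λ)`.  HERE (the MECHANISM of E″'s endpoint recursion, made rigorous at the interface's regularity):
the defect `N(x) := 2x f′_w(x) + ((2πλx)² − χ) f(x)` equals `(λ² − x²) f″_w(x)` on the closed window, vanishes at `x = λ`,
and its difference quotient at `λ` is `−(x + λ) f″_w(x) → −2λ f″_w(λ)` by mere CONTINUITY of `f″_w` — so `N` is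
differentiable within the window at `λ` with derivative `−2λ f″_w(λ)`, while the product rule computes the same derivative
as `2 f′_w(λ) + 2λ f″_w(λ) + 8π²λ³ f(λ) + (C − χ)·f′_w(λ)`… equating (uniqueness of within-derivatives on `[−λ, λ]`):
  `4λ f″_w(λ) + (2 + C − χ) f′_w(λ) + 8π²λ³ f(λ) = 0`     (`i = 1` case of the recursion; in prolate units
  `4ψ″(1) = (χ − c² − 2) ψ′(1) − 2c² ψ(1)`),
hence the EDGE JET IS SLAVED TO THE EDGE VALUE:
  `f′_w(λ) = (χ − C) f(λ) / (2λ)`,   `f″_w(λ) = ((χ − C)(χ − C − 2) / (8λ²) − 2π²λ²) · f(λ)`,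
and, under the spectral inequality `0 < χ < C` (bundle (I2); a hypothesis, not part of the interface), LEMMA B of E″ for
`i = 1, 2`:  `|f′_w(λ)| ≤ C |f(λ)| / (2λ)`,  `|f″_w(λ)| ≤ (C² / (8λ²) + 3C / (4λ²)) · |f(λ)|`… stated below in the
exact forms proved (prolate units: `|ψ′(1)| ≤ c² ε / 2`, `|ψ″(1)| ≤ (c⁴/8 + 3c²/4) ε ≤ c⁴ ε / 2` for `c ≥ 2`).
INTERFACE CEILING (recorded, not a defect of the argument): the same slope argument yields the order-`i` identity from
`C^{i+1}` regularity on the closed window; `IsProlateFunction` provides `C²`, so `i = 1` is the last identity available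
from the interface as it stands (E″ on paper uses all `i ≤ c/2`, from analyticity — a definition request for a richer
prolate interface is noted in HOME/HANDOFF.md).
[cite: connes-x13 bundle PROOF-ATTEMPT §3.6 (Lemma 2, endpoint recursion); HOME/M2-ROUTE.md §9.2 Lemma B; referee r9 (R1, R2)]
-/

noncomputable section

set_option linter.dupNamespace false  -- the mandated namespace repeats `RiemannHypothesis`

open Set Filter Topology
open Literature.NumberTheory.LFunctions

namespace Summit.RiemannHypothesis.RiemannHypothesis.Theorems.PfPersistenceM2Leak

section ProlateEdgeTwo

variable {lam : ℝ} {n : ℕ} {f : ℝ → ℝ}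

/-- **Second-order window-edge identity** (`i = 1` case of E″'s endpoint recursion), from `C²` regularity on the closed
window and the eigen-equation on the open window alone:
`4λ f″_w(λ) + (2 + (2πλ²)² − χ) f′_w(λ) + 8π²λ³ f(λ) = 0`. -/
theorem prolate_second_edge_identity (h : IsProlateFunction lam n f) {χ : ℝ}
    (hχ : ∀ x ∈ Ioo (-lam) lam,
      -(deriv (fun y ↦ (lam ^ 2 - y ^ 2) * deriv f y) x) + (2 * Real.pi * lam * x) ^ 2 * f x = χ * f x) :
    4 * lam * derivWithin (derivWithin f (Icc (-lam) lam)) (Icc (-lam) lam) lam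
      + (2 + (2 * Real.pi * lam ^ 2) ^ 2 - χ) * derivWithin f (Icc (-lam) lam) lam
      + 8 * Real.pi ^ 2 * lam ^ 3 * f lam = 0 := by
  have hl : 0 < lam := h.lam_pos
  have hll : -lam < lam := by linarith
  set s : Set ℝ := Icc (-lam) lam with hs_def
  have hs : UniqueDiffOn ℝ s := uniqueDiffOn_Icc hll
  have hmem : lam ∈ s := ⟨by linarith, le_rfl⟩
  set f1 : ℝ → ℝ := derivWithin f s with hf1_def
  set f2 : ℝ → ℝ := derivWithin f1 s with hf2_def
  have hf : ContDiffOn ℝ 2 f s := h.contDiffOn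
  have hf1 : ContDiffOn ℝ 1 f1 s := hf.derivWithin hs (by norm_num)
  have hf2c : ContinuousOn f2 s := hf1.continuousOn_derivWithin hs le_rfl
  -- closed-window equation: N x = (lam² - x²) f2 x on s
  have hI := prolate_eqOn_Icc_of_eigen h hχ
  set N : ℝ → ℝ := fun x ↦ 2 * x * f1 x + ((2 * Real.pi * lam * x) ^ 2 - χ) * f x with hN_def
  have hN : ∀ x ∈ s, N x = (lam ^ 2 - x ^ 2) * f2 x := by
    intro x hx
    have := hI x hx
    simp only [hN_def]
    linarith
  have hNl : N lam = 0 := by rw [hN lam hmem]; simp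
  -- (A) derivative of N within s at lam by the product rule
  have hf' : HasDerivWithinAt f (f1 lam) s lam :=
    ((hf.differentiableOn (by norm_num)) lam hmem).hasDerivWithinAt
  have hf1' : HasDerivWithinAt f1 (f2 lam) s lam :=
    ((hf1.differentiableOn one_ne_zero) lam hmem).hasDerivWithinAt
  have h2x : HasDerivWithinAt (fun x : ℝ ↦ 2 * x) 2 s lam := by
    simpa using ((hasDerivAt_id lam).const_mul 2).hasDerivWithinAt
  have hq : HasDerivWithinAt (fun x : ℝ ↦ (2 * Real.pi * lam * x) ^ 2 - χ)
      (2 * (2 * Real.pi * lam * lam) * (2 * Real.pi * lam)) s lam := by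
    have h1 : HasDerivAt (fun x : ℝ ↦ 2 * Real.pi * lam * x) (2 * Real.pi * lam) lam := by
      simpa using (hasDerivAt_id lam).const_mul (2 * Real.pi * lam)
    have h2 := (h1.pow 2).sub_const χ
    simpa using h2.hasDerivWithinAt
  have hA : HasDerivWithinAt N
      (2 * f1 lam + 2 * lam * f2 lam
        + (2 * (2 * Real.pi * lam * lam) * (2 * Real.pi * lam) * f lam
          + ((2 * Real.pi * lam * lam) ^ 2 - χ) * f1 lam)) s lam := by
    have := (h2x.mul hf1').add (hq.mul hf')
    have hfun : ((fun x : ℝ ↦ 2 * x) * f1 + (fun x : ℝ ↦ (2 * Real.pi * lam * x) ^ 2 - χ) * f) = N := by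
      funext x; simp only [hN_def, Pi.add_apply, Pi.mul_apply]
    rw [hfun] at this
    exact this
  -- (B) derivative of N within s at lam from the slope, using only continuity of f2
  have hB : HasDerivWithinAt N (-(2 * lam) * f2 lam) s lam := by
    rw [hasDerivWithinAt_iff_tendsto_slope]
    have hcont : ContinuousWithinAt (fun x ↦ -(x + lam) * f2 x) s lam :=
      ((continuous_id.add continuous_const).neg.continuousWithinAt).mul (hf2c lam hmem)
    have hlim : Tendsto (fun x ↦ -(x + lam) * f2 x) (𝓝[s \ {lam}] lam) (𝓝 (-(2 * lam) * f2 lam)) := by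
      have hsub : s \ {lam} ⊆ s := fun x hx ↦ hx.1
      have := hcont.tendsto.mono_left (nhdsWithin_mono lam hsub)
      simpa [two_mul] using this
    refine hlim.congr' ?_
    filter_upwards [self_mem_nhdsWithin] with x hx
    have hxs : x ∈ s := hx.1
    have hxne : x ≠ lam := hx.2
    have hxl : x - lam ≠ 0 := sub_ne_zero.mpr hxne
    rw [slope_def_field, hNl, sub_zero, hN x hxs]
    have e : lam ^ 2 - x ^ 2 = -(x + lam) * (x - lam) := by ring
    rw [e]
    field_simp
  -- (C) uniqueness
  have huniq := (hs lam hmem).eq_deriv _ hA hB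
  have e1 : (2 * Real.pi * lam * lam) ^ 2 = (2 * Real.pi * lam ^ 2) ^ 2 := by ring
  have e2 : 2 * (2 * Real.pi * lam * lam) * (2 * Real.pi * lam) = 8 * Real.pi ^ 2 * lam ^ 3 := by ring
  rw [e1, e2] at huniq
  linarith

/-- **The edge jet is slaved to the edge value (order 1).**  `f′_w(λ) = (χ − (2πλ²)²)·f(λ)/(2λ)`. -/
theorem prolate_edge_first_value (h : IsProlateFunction lam n f) {χ : ℝ}
    (hχ : ∀ x ∈ Ioo (-lam) lam,
      -(deriv (fun y ↦ (lam ^ 2 - y ^ 2) * deriv f y) x) + (2 * Real.pi * lam * x) ^ 2 * f x = χ * f x) :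
    derivWithin f (Icc (-lam) lam) lam = (χ - (2 * Real.pi * lam ^ 2) ^ 2) * f lam / (2 * lam) := by
  have hl : 0 < lam := h.lam_pos
  have hid := prolate_derivWithin_right_edge h hχ
  rw [eq_div_iff (by positivity)]
  linarith

/-- **The edge jet is slaved to the edge value (order 2).**
`f″_w(λ) = ((χ − C)(χ − C − 2)/(8λ²) − 2π²λ²)·f(λ)`, `C = (2πλ²)²` (prolate units:
`ψ″(1) = [(χ − c²)(χ − c² − 2)/8 − c²/2]·ψ(1)`). -/
theorem prolate_edge_second_value (h : IsProlateFunction lam n f) {χ : ℝ}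
    (hχ : ∀ x ∈ Ioo (-lam) lam,
      -(deriv (fun y ↦ (lam ^ 2 - y ^ 2) * deriv f y) x) + (2 * Real.pi * lam * x) ^ 2 * f x = χ * f x) :
    derivWithin (derivWithin f (Icc (-lam) lam)) (Icc (-lam) lam) lam
      = ((χ - (2 * Real.pi * lam ^ 2) ^ 2) * (χ - (2 * Real.pi * lam ^ 2) ^ 2 - 2) / (8 * lam ^ 2)
          - 2 * Real.pi ^ 2 * lam ^ 2) * f lam := by
  have hl : 0 < lam := h.lam_pos
  have h2 := prolate_second_edge_identity h hχ
  have h1 := prolate_derivWithin_right_edge h hχ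
  have hl2 : (8 : ℝ) * lam ^ 2 ≠ 0 := by positivity
  -- 8λ² f″ = ((χ − C)(χ − C − 2) − 16π²λ⁴) f
  have key : 8 * lam ^ 2 * derivWithin (derivWithin f (Icc (-lam) lam)) (Icc (-lam) lam) lam
      = ((χ - (2 * Real.pi * lam ^ 2) ^ 2) * (χ - (2 * Real.pi * lam ^ 2) ^ 2 - 2)
          - 16 * Real.pi ^ 2 * lam ^ 4) * f lam := by
    linear_combination 2 * lam * h2 - (2 + (2 * Real.pi * lam ^ 2) ^ 2 - χ) * h1
  rw [sub_mul, div_mul_eq_mul_div, eq_sub_iff_add_eq, eq_div_iff hl2]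
  linear_combination key

/-- **LEMMA B of E″, order 1** (kernel-checked rung): under the spectral inequality `0 < χ < C = (2πλ²)²`
(bundle (I2), a hypothesis here), `|f′_w(λ)| ≤ C·|f(λ)|/(2λ)` — prolate units `|ψ′(1)| ≤ c² ε / 2 ≤ ε c² / 1!`. -/
theorem prolate_abs_edge_first_le (h : IsProlateFunction lam n f) {χ : ℝ}
    (hχ : ∀ x ∈ Ioo (-lam) lam,
      -(deriv (fun y ↦ (lam ^ 2 - y ^ 2) * deriv f y) x) + (2 * Real.pi * lam * x) ^ 2 * f x = χ * f x)
    (hχ0 : 0 < χ) (hχc : χ < (2 * Real.pi * lam ^ 2) ^ 2) :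
    |derivWithin f (Icc (-lam) lam) lam| ≤ (2 * Real.pi * lam ^ 2) ^ 2 * |f lam| / (2 * lam) := by
  have hl : 0 < lam := h.lam_pos
  rw [prolate_edge_first_value h hχ, abs_div, abs_mul, abs_of_pos (by positivity : (0:ℝ) < 2 * lam)]
  gcongr
  rw [abs_sub_comm, abs_of_pos (by linarith)]
  linarith

/-- **LEMMA B of E″, order 2** (kernel-checked rung): under `0 < χ < C = (2πλ²)²`,
`|f″_w(λ)| ≤ (C·(C + 2)/(8λ²) + 2π²λ²)·|f(λ)|` — prolate units `|ψ″(1)| ≤ (c⁴/8 + 3c²/4)·ε`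
(`2π²λ⁴ = c²/4`), which is `≤ ε c⁴ / 2!` as soon as `c ≥ 2`. -/
theorem prolate_abs_edge_second_le (h : IsProlateFunction lam n f) {χ : ℝ}
    (hχ : ∀ x ∈ Ioo (-lam) lam,
      -(deriv (fun y ↦ (lam ^ 2 - y ^ 2) * deriv f y) x) + (2 * Real.pi * lam * x) ^ 2 * f x = χ * f x)
    (hχ0 : 0 < χ) (hχc : χ < (2 * Real.pi * lam ^ 2) ^ 2) :
    |derivWithin (derivWithin f (Icc (-lam) lam)) (Icc (-lam) lam) lam|
      ≤ ((2 * Real.pi * lam ^ 2) ^ 2 * ((2 * Real.pi * lam ^ 2) ^ 2 + 2) / (8 * lam ^ 2)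
          + 2 * Real.pi ^ 2 * lam ^ 2) * |f lam| := by
  have hl : 0 < lam := h.lam_pos
  set C : ℝ := (2 * Real.pi * lam ^ 2) ^ 2 with hC
  rw [prolate_edge_second_value h hχ, abs_mul]
  gcongr
  have hCpos : 0 < C := by positivity
  have h8 : (0:ℝ) < 8 * lam ^ 2 := by positivity
  have hA : |(χ - C) * (χ - C - 2) / (8 * lam ^ 2)| ≤ C * (C + 2) / (8 * lam ^ 2) := by
    rw [abs_div, abs_of_pos h8, div_le_div_iff_of_pos_right h8, abs_mul]
    have h1 : |χ - C| ≤ C := by rw [abs_sub_comm, abs_of_pos (by linarith)]; linarith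
    have h2 : |χ - C - 2| ≤ C + 2 := by
      rw [show χ - C - 2 = -(C + 2 - χ) by ring, abs_neg, abs_of_pos (by linarith)]; linarith
    exact mul_le_mul h1 h2 (abs_nonneg _) hCpos.le
  have hB : |(2 : ℝ) * Real.pi ^ 2 * lam ^ 2| = 2 * Real.pi ^ 2 * lam ^ 2 := abs_of_pos (by positivity)
  calc |(χ - C) * (χ - C - 2) / (8 * lam ^ 2) - 2 * Real.pi ^ 2 * lam ^ 2|
      ≤ |(χ - C) * (χ - C - 2) / (8 * lam ^ 2)| + |(2 : ℝ) * Real.pi ^ 2 * lam ^ 2| := abs_sub _ _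
    _ ≤ C * (C + 2) / (8 * lam ^ 2) + 2 * Real.pi ^ 2 * lam ^ 2 := by rw [hB]; exact add_le_add hA le_rfl

/-- **Existential packaging over the interface's own eigenvalue**: every prolate function satisfies the second-order
edge identity (with the `χ` of `IsProlateFunction.eigen`), alongside the first-order one. -/
theorem prolate_exists_second_edge_identity (h : IsProlateFunction lam n f) :
    ∃ χ : ℝ, 2 * lam * derivWithin f (Icc (-lam) lam) lam = (χ - (2 * Real.pi * lam ^ 2) ^ 2) * f lam ∧
      4 * lam * derivWithin (derivWithin f (Icc (-lam) lam)) (Icc (-lam) lam) lam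
        + (2 + (2 * Real.pi * lam ^ 2) ^ 2 - χ) * derivWithin f (Icc (-lam) lam) lam
        + 8 * Real.pi ^ 2 * lam ^ 3 * f lam = 0 := by
  obtain ⟨χ, hχ⟩ := h.eigen
  exact ⟨χ, prolate_derivWithin_right_edge h hχ, prolate_second_edge_identity h hχ⟩

end ProlateEdgeTwo

end Summit.RiemannHypothesis.RiemannHypothesis.Theorems.PfPersistenceM2Leak

end
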